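import Mathlib
import Summits.NavierStokesRegularity.NavierStokesRegularity.Theorems.SubOnsagerCeilingSideBranchLinger
import Summits.NavierStokesRegularity.NavierStokesRegularity.Theorems.SubOnsagerCeilingSideBranchSideRelax
import Literature.NumberTheory.LFunctions.PrimeReciprocalWindows
import HarnessLib

/-!
# Route SubOnsagerCeiling — the TRANSITING MODES of ANY shell of `α_SB` RELAX behind a quiet feed
# (helper file for item stmt-NavierStokesRegularity-25507 `OrthantTailCeiling`; `--supports`; def-free)

Brick «R-B» of the escape construction behind the conditional refutations of the aside cruxes
`OrthantTailCeiling` (stmt-25507) / `ForwardTailCeiling` (stmt-26608) on the side-branch dead-end table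
`α_SB = sideBranchTable` (negative lemmas p824789 / p824871; the remaining debt is that a fixed fraction of
the energy leaves every finite block by a `ν`-uniform time, `…SideBranchFractionEscape.lean`).  To turn
«the block `0..K` keeps energy» into «the POCKETS `z_1..z_K` keep energy» one needs the chain modes `x_k`
and side modes `s_k` of the block to be small at a late, viscosity-uniform time.  The datum shell (`k = 0`,
no feed) is p825888 / p826019.  This file does EVERY shell `k`, fed from below by `Λ_{k-1}x_{k-1}²`:

* `sideBranch_chain_regrowth` — with the feed bounded, `Λ_{k-1}x_{k-1}² ≤ φ`, and `x_k, x_{k+1}, s_k ≥ 0`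
  on `[τ, t₁]`: `x_k(t) ≤ x_k(τ) + φ·(t − τ)` (the chain mode is only fed from below);
* `sideBranch_chain_dip` — contrapositive of the linger bound p825747: next to a pocket capped by `Z`, in a
  window `[t₀,t₁]` with `Z(1 + ν_{k+1}(t₁−t₀)) < (Λ_k/5)(a/(5r₁))²((t₁−t₀) − (1+log 2)/r₁)`,
  `r₁ = Λ_kZ/5 + ν_k`, the chain mode dips: `Λ_k x_k(τ)² < a` at some `τ`;
* `sideBranch_side_regrowth` — with `Λ_k x_k² ≤ a`, `s_k, z_{k+1} ≥ 0` on `[τ,t₁]`: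
  `s_k(t) ≤ s_k(τ) + (a/5)(t − τ)`;
* `sideBranch_side_dip` — next to a pocket capped by `Z`, the side mode dips to `≤ σ` within
  `Δ = 10Z/(Λ_kσ²) + 1` (else the pocket drive p825420 overfills the pocket), for `ν_{k+1}Δ ≤ 1`;
* **`sideBranch_shell_transit_relax`** — assembly: on a window `[t₀, T]` with `T − t₀ ≥ L + Δ`, feed
  `≤ φ`, signs, pocket `0 ≤ z_{k+1} ≤ Z`, and the parameter conditions `φL ≤ r`,
  `(4/5)Λ_k r²Δ ≤ σ`, `ν_{k+1}L ≤ 1`, `ν_{k+1}Δ ≤ 1` and the dip condition at length `L`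
  (`2Z < (Λ_k/5)(Λ_k r²/(5r₁))²(L − (1+log 2)/r₁)`): **`x_k(T) < 2r` and `s_k(T) ≤ 2σ`**, hence
  `½x_k(T)² + ½s_k(T)² ≤ 2r² + 2σ²` (`sideBranch_shell_transit_energy`).
  Given `σ`, then `r`, then `L`, then `φ` (and `ν` last) the conditions are met, and `φ = 4Λ_{k-1}r_{k-1}²`
  is supplied by the same theorem one shell below — the block induction is bookkeeping on top of this file.

HONEST FRAMING: elementary real analysis of a Tao-type MODEL lattice ODE (route SubOnsagerCeiling, rung
TL-M2Break); a brick toward a construction that is NOT carried out here; nothing bears on Navier–Stokes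
regularity; no crux is settled here. [cite: Tao2016AveragedNS, §4 (4.2)–(4.3)];
Katz–Pavlović couplings: [cite: BarbatoMorandinRomito2011, §2].
-/

noncomputable section

-- the sub-problem namespace `NavierStokesRegularity.NavierStokesRegularity` is the tree's layout (D-0017)
set_option linter.dupNamespace false

namespace Summit.NavierStokesRegularity.NavierStokesRegularity.Theorems.SubOnsagerCeiling

open Set
open Literature.Analysis.FluidPDE.TaoCascade

section Solution

variable {ε₀ ν s : ℝ} {X : Fin 4 → ℤ → ℝ → ℝ}

/-! ## The chain mode of a fed shell: bounded regrowth and the dip -/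

/-- **Bounded regrowth of a fed chain mode.** Along a regular solution of the `ν`-viscous `α_SB` lattice on
`[0,s]` (`ν ≥ 0`), let `[τ,t₁] ⊆ [0,s]` and suppose on `[τ,t₁]`: the feed is bounded,
`Λ_{k-1}x_{k-1}² ≤ φ`, and `x_k, x_{k+1}, s_k ≥ 0`.  Then `x_k(t) ≤ x_k(τ) + φ(t − τ)` on `[τ,t₁]`
(`ẋ_k = Λ_{k-1}x_{k-1}² − Λ_k x_k(x_{k+1} + s_k/5) − ν_k x_k ≤ φ`). [this file] -/
theorem sideBranch_chain_regrowth (hε : 0 < ε₀) (hν : 0 ≤ ν)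
    (hder : ∀ (i : Fin 4) (k : ℤ), ∀ t ∈ Icc (0 : ℝ) s, HasDerivWithinAt (X i k)
      (quadTerm ε₀ sideBranchTable X i k t - ν * (1 + ε₀) ^ ((2 : ℝ) * k) * X i k t)
      (Icc (0 : ℝ) s) t)
    (k : ℤ) {τ t₁ φ : ℝ} (hτ : 0 ≤ τ) (ht₁ : t₁ ≤ s)
    (hfeed : ∀ u ∈ Icc τ t₁, (1 + ε₀) ^ ((5 : ℝ) * ((k : ℝ) - 1) / 2) * X 0 (k - 1) u ^ 2 ≤ φ)
    (hxk : ∀ u ∈ Icc τ t₁, 0 ≤ X 0 k u)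
    (hx1 : ∀ u ∈ Icc τ t₁, 0 ≤ X 0 (k + 1) u)
    (hsk : ∀ u ∈ Icc τ t₁, 0 ≤ X 1 k u) {t : ℝ} (ht : t ∈ Icc τ t₁) :
    X 0 k t ≤ X 0 k τ + φ * (t - τ) := by
  have hb : (0 : ℝ) < 1 + ε₀ := by linarith
  set Λ : ℝ := (1 + ε₀) ^ ((5 : ℝ) * k / 2) with hΛ
  set c₀ : ℝ := ν * (1 + ε₀) ^ ((2 : ℝ) * k) with hc₀
  have hΛ0 : 0 < Λ := Real.rpow_pos_of_pos hb _
  have hc₀0 : 0 ≤ c₀ := mul_nonneg hν (Real.rpow_nonneg hb.le _)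
  have hsub : Icc τ t₁ ⊆ Icc (0 : ℝ) s := Icc_subset_Icc hτ ht₁
  set Φ : ℝ → ℝ := fun u => X 0 k τ + φ * (u - τ) - X 0 k u with hΦ
  have hderΦ : ∀ u ∈ Icc τ t₁, HasDerivWithinAt Φ
      (φ * 1 - (quadTerm ε₀ sideBranchTable X 0 k u - c₀ * X 0 k u)) (Icc τ t₁) u := by
    intro u hu
    have h1 : HasDerivWithinAt (fun u => X 0 k τ + φ * (u - τ)) (φ * 1) (Icc τ t₁) u :=
      (((hasDerivWithinAt_id u (Icc τ t₁)).sub_const τ).const_mul φ).const_add (X 0 k τ)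
    exact h1.sub ((hder 0 k u (hsub hu)).mono hsub)
  have hnn : ∀ u ∈ Icc τ t₁, 0 ≤ φ * 1 - (quadTerm ε₀ sideBranchTable X 0 k u - c₀ * X 0 k u) := by
    intro u hu
    rw [sideBranch_quadTerm_zero, ← hΛ]
    have h1 := hfeed u hu
    have h2 : 0 ≤ Λ * (X 0 k u * X 0 (k + 1) u) :=
      mul_nonneg hΛ0.le (mul_nonneg (hxk u hu) (hx1 u hu))
    have h3 : 0 ≤ (1 / 5 : ℝ) * Λ * (X 0 k u * X 1 k u) :=
      mul_nonneg (by positivity) (mul_nonneg (hxk u hu) (hsk u hu))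
    have h4 : 0 ≤ c₀ * X 0 k u := mul_nonneg hc₀0 (hxk u hu)
    linarith
  have h := sideBranch_le_of_deriv_nonneg hderΦ hnn ht
  simp only [hΦ, sub_self, mul_zero, add_zero] at h
  linarith

/-- **The chain mode dips (contrapositive of the linger bound).** Along a regular solution of the
`ν`-viscous `α_SB` lattice on `[0,s]` (`ν ≥ 0`), let `[t₀,t₁] ⊆ [0,s]` and suppose on `[t₀,t₁]`:
`s_k ≥ 0` and `0 ≤ z_{k+1} ≤ Z` (`Z > 0`).  If the window is long in the sense
`Z(1 + ν_{k+1}(t₁−t₀)) < (Λ_k/5)(a/(5r₁))²((t₁ − t₀) − (1+log 2)/r₁)`, `r₁ = Λ_kZ/5 + ν_k`, `a ≥ 0`, then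
`Λ_k x_k(τ)² < a` at some `τ ∈ [t₀,t₁]` (else p825747 is violated). [this file] -/
theorem sideBranch_chain_dip (hε : 0 < ε₀) (hν : 0 ≤ ν)
    (hder : ∀ (i : Fin 4) (k : ℤ), ∀ t ∈ Icc (0 : ℝ) s, HasDerivWithinAt (X i k)
      (quadTerm ε₀ sideBranchTable X i k t - ν * (1 + ε₀) ^ ((2 : ℝ) * k) * X i k t)
      (Icc (0 : ℝ) s) t)
    (k : ℤ) {t₀ t₁ a Z : ℝ} (ht₀ : 0 ≤ t₀) (ht₀₁ : t₀ ≤ t₁) (ht₁ : t₁ ≤ s) (ha : 0 ≤ a) (hZ : 0 < Z)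
    (hsk : ∀ u ∈ Icc t₀ t₁, 0 ≤ X 1 k u)
    (hz0 : ∀ u ∈ Icc t₀ t₁, 0 ≤ X 2 (k + 1) u)
    (hzZ : ∀ u ∈ Icc t₀ t₁, X 2 (k + 1) u ≤ Z)
    (hlong : Z * (1 + ν * (1 + ε₀) ^ ((2 : ℝ) * ((k + 1 : ℤ) : ℝ)) * (t₁ - t₀)) <
      (1 / 5 : ℝ) * (1 + ε₀) ^ ((5 : ℝ) * k / 2) *
        (a / (5 * ((1 / 5 : ℝ) * (1 + ε₀) ^ ((5 : ℝ) * k / 2) * Z + ν * (1 + ε₀) ^ ((2 : ℝ) * k)))) ^ 2 *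
        ((t₁ - t₀) - (1 + Real.log 2) /
          ((1 / 5 : ℝ) * (1 + ε₀) ^ ((5 : ℝ) * k / 2) * Z + ν * (1 + ε₀) ^ ((2 : ℝ) * k)))) :
    ∃ τ ∈ Icc t₀ t₁, (1 + ε₀) ^ ((5 : ℝ) * k / 2) * X 0 k τ ^ 2 < a := by
  by_contra hcon
  push Not at hcon
  have h := sideBranch_linger_bound hε hν hder k ht₀ ht₀₁ ht₁ ha hZ hcon hsk hz0 hzZ
  linarith

/-! ## The side mode of a shell: bounded regrowth and the dip -/

/-- **Bounded regrowth of the side mode.** Along a regular solution of the `ν`-viscous `α_SB` lattice on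
`[0,s]` (`ν ≥ 0`), let `[τ,t₁] ⊆ [0,s]` and suppose on `[τ,t₁]`: `Λ_k x_k² ≤ a`, `s_k ≥ 0`, `z_{k+1} ≥ 0`.
Then `s_k(t) ≤ s_k(τ) + (a/5)(t − τ)` on `[τ,t₁]` (`ṡ_k = Λ_k(x_k² − s_k z_{k+1})/5 − ν_k s_k ≤ a/5`).
[this file] -/
theorem sideBranch_side_regrowth (hε : 0 < ε₀) (hν : 0 ≤ ν)
    (hder : ∀ (i : Fin 4) (k : ℤ), ∀ t ∈ Icc (0 : ℝ) s, HasDerivWithinAt (X i k)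
      (quadTerm ε₀ sideBranchTable X i k t - ν * (1 + ε₀) ^ ((2 : ℝ) * k) * X i k t)
      (Icc (0 : ℝ) s) t)
    (k : ℤ) {τ t₁ a : ℝ} (hτ : 0 ≤ τ) (ht₁ : t₁ ≤ s)
    (hxa : ∀ u ∈ Icc τ t₁, (1 + ε₀) ^ ((5 : ℝ) * k / 2) * X 0 k u ^ 2 ≤ a)
    (hsk : ∀ u ∈ Icc τ t₁, 0 ≤ X 1 k u)
    (hz0 : ∀ u ∈ Icc τ t₁, 0 ≤ X 2 (k + 1) u) {t : ℝ} (ht : t ∈ Icc τ t₁) :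
    X 1 k t ≤ X 1 k τ + a / 5 * (t - τ) := by
  have hb : (0 : ℝ) < 1 + ε₀ := by linarith
  set Λ : ℝ := (1 + ε₀) ^ ((5 : ℝ) * k / 2) with hΛ
  set c₀ : ℝ := ν * (1 + ε₀) ^ ((2 : ℝ) * k) with hc₀
  have hΛ0 : 0 < Λ := Real.rpow_pos_of_pos hb _
  have hc₀0 : 0 ≤ c₀ := mul_nonneg hν (Real.rpow_nonneg hb.le _)
  have hsub : Icc τ t₁ ⊆ Icc (0 : ℝ) s := Icc_subset_Icc hτ ht₁
  set Φ : ℝ → ℝ := fun u => X 1 k τ + a / 5 * (u - τ) - X 1 k u with hΦ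
  have hderΦ : ∀ u ∈ Icc τ t₁, HasDerivWithinAt Φ
      (a / 5 * 1 - (quadTerm ε₀ sideBranchTable X 1 k u - c₀ * X 1 k u)) (Icc τ t₁) u := by
    intro u hu
    have h1 : HasDerivWithinAt (fun u => X 1 k τ + a / 5 * (u - τ)) (a / 5 * 1) (Icc τ t₁) u :=
      (((hasDerivWithinAt_id u (Icc τ t₁)).sub_const τ).const_mul (a / 5)).const_add (X 1 k τ)
    exact h1.sub ((hder 1 k u (hsub hu)).mono hsub)
  have hnn : ∀ u ∈ Icc τ t₁, 0 ≤ a / 5 * 1 - (quadTerm ε₀ sideBranchTable X 1 k u - c₀ * X 1 k u) := by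
    intro u hu
    rw [sideBranch_quadTerm_one, ← hΛ]
    have h1 := hxa u hu
    have h2 : 0 ≤ (1 / 5 : ℝ) * Λ * (X 1 k u * X 2 (k + 1) u) :=
      mul_nonneg (by positivity) (mul_nonneg (hsk u hu) (hz0 u hu))
    have h3 : 0 ≤ c₀ * X 1 k u := mul_nonneg hc₀0 (hsk u hu)
    have h4 : (1 / 5 : ℝ) * Λ * X 0 k u ^ 2 ≤ a / 5 := by
      have : (1 / 5 : ℝ) * Λ * X 0 k u ^ 2 = (1 / 5 : ℝ) * (Λ * X 0 k u ^ 2) := by ring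
      rw [this]; linarith
    linarith
  have h := sideBranch_le_of_deriv_nonneg hderΦ hnn ht
  simp only [hΦ, sub_self, mul_zero, add_zero] at h
  linarith

/-- **The side mode dips (a capped pocket cannot be driven for long).** Along a regular solution of the
`ν`-viscous `α_SB` lattice on `[0,s]` (`ν > 0`), let `Δ = 10Z/(Λ_kσ²) + 1` (`σ, Z > 0`), `[t₀, t₀+Δ] ⊆ [0,s]`,
and suppose on `[t₀,t₀+Δ]`: `0 ≤ z_{k+1} ≤ Z`, and `ν_{k+1}Δ ≤ 1`.  Then `s_k(τ) ≤ σ` at some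
`τ ∈ [t₀, t₀+Δ]`: otherwise `Λ_k s_k² ≥ Λ_kσ²` drives the pocket to `≥ (Λ_kσ²/10)·Δ = Z + Λ_kσ²/10 > Z`
(p825420 with `1 − e^{-x} ≥ x/2` on `[0,1]`). [this file] -/
theorem sideBranch_side_dip (hε : 0 < ε₀) (hν : 0 < ν)
    (hder : ∀ (i : Fin 4) (k : ℤ), ∀ t ∈ Icc (0 : ℝ) s, HasDerivWithinAt (X i k)
      (quadTerm ε₀ sideBranchTable X i k t - ν * (1 + ε₀) ^ ((2 : ℝ) * k) * X i k t)
      (Icc (0 : ℝ) s) t)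
    (k : ℤ) {t₀ σ Z : ℝ} (ht₀ : 0 ≤ t₀) (hσ : 0 < σ) (hZ : 0 < Z)
    (hΔs : t₀ + (10 * Z / ((1 + ε₀) ^ ((5 : ℝ) * k / 2) * σ ^ 2) + 1) ≤ s)
    (hz0 : ∀ u ∈ Icc t₀ (t₀ + (10 * Z / ((1 + ε₀) ^ ((5 : ℝ) * k / 2) * σ ^ 2) + 1)),
      0 ≤ X 2 (k + 1) u)
    (hzZ : ∀ u ∈ Icc t₀ (t₀ + (10 * Z / ((1 + ε₀) ^ ((5 : ℝ) * k / 2) * σ ^ 2) + 1)),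
      X 2 (k + 1) u ≤ Z)
    (hνΔ : ν * (1 + ε₀) ^ ((2 : ℝ) * ((k + 1 : ℤ) : ℝ)) *
      (10 * Z / ((1 + ε₀) ^ ((5 : ℝ) * k / 2) * σ ^ 2) + 1) ≤ 1) :
    ∃ τ ∈ Icc t₀ (t₀ + (10 * Z / ((1 + ε₀) ^ ((5 : ℝ) * k / 2) * σ ^ 2) + 1)), X 1 k τ ≤ σ := by
  have hb : (0 : ℝ) < 1 + ε₀ := by linarith
  set Λ : ℝ := (1 + ε₀) ^ ((5 : ℝ) * k / 2) with hΛ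
  set c₁ : ℝ := ν * (1 + ε₀) ^ ((2 : ℝ) * ((k + 1 : ℤ) : ℝ)) with hc₁
  have hΛ0 : 0 < Λ := Real.rpow_pos_of_pos hb _
  have hc₁0 : 0 < c₁ := mul_pos hν (Real.rpow_pos_of_pos hb _)
  set Δ : ℝ := 10 * Z / (Λ * σ ^ 2) + 1 with hΔdef
  have hΔ0 : 0 < Δ := by
    have h1 : 0 ≤ 10 * Z / (Λ * σ ^ 2) := by positivity
    rw [hΔdef]; linarith
  by_contra hcon
  push Not at hcon
  have hsk : ∀ u ∈ Icc t₀ (t₀ + Δ), 5 * ((1 / 5 : ℝ) * Λ * σ ^ 2) ≤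
      (1 + ε₀) ^ ((5 : ℝ) * k / 2) * X 1 k u ^ 2 := by
    intro u hu
    rw [← hΛ]
    have h1 : σ ^ 2 ≤ X 1 k u ^ 2 := pow_le_pow_left₀ hσ.le (hcon u hu).le 2
    have h2 : Λ * σ ^ 2 ≤ Λ * X 1 k u ^ 2 := mul_le_mul_of_nonneg_left h1 hΛ0.le
    linarith
  have hdr := sideBranch_pocket_drive hε hν hder k ht₀ hΔs hsk hz0
    (right_mem_Icc.2 (by linarith))
  rw [← hc₁] at hdr
  have hwin : t₀ + Δ - t₀ = Δ := by ring
  rw [hwin] at hdr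
  -- `(p/ν_{k+1})(1 − e^{−ν_{k+1}Δ}) ≥ pΔ/2 = Z + Λσ²/10 > Z`
  have hx1 : c₁ * Δ ≤ 1 := by rw [hc₁, hΔdef, hΛ]; exact hνΔ
  have hhalf := Literature.NumberTheory.LFunctions.PrimeReciprocal.half_le_one_sub_exp_neg
    (by positivity : 0 ≤ c₁ * Δ) hx1
  have hzcap : X 2 (k + 1) (t₀ + Δ) ≤ Z := hzZ (t₀ + Δ) (right_mem_Icc.2 (by linarith))
  have hp0 : 0 ≤ (1 / 5 : ℝ) * Λ * σ ^ 2 / c₁ := by positivity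
  have h1 : (1 / 5 : ℝ) * Λ * σ ^ 2 / c₁ * (c₁ * Δ / 2) ≤
      (1 / 5 : ℝ) * Λ * σ ^ 2 / c₁ * (1 - Real.exp (-(c₁ * Δ))) :=
    mul_le_mul_of_nonneg_left hhalf hp0
  have h2 : (1 / 5 : ℝ) * Λ * σ ^ 2 / c₁ * (c₁ * Δ / 2) = Z + Λ * σ ^ 2 / 10 := by
    rw [hΔdef]; field_simp; ring
  have h3 : 0 < Λ * σ ^ 2 / 10 := by positivity
  have h4 : Z + Λ * σ ^ 2 / 10 ≤ Z :=
    calc Z + Λ * σ ^ 2 / 10 = (1 / 5 : ℝ) * Λ * σ ^ 2 / c₁ * (c₁ * Δ / 2) := h2.symm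
      _ ≤ (1 / 5 : ℝ) * Λ * σ ^ 2 / c₁ * (1 - Real.exp (-(c₁ * Δ))) := h1
      _ ≤ X 2 (k + 1) (t₀ + Δ) := hdr
      _ ≤ Z := hzcap
  linarith

/-! ## Assembly: the transiting modes of a shell behind a quiet feed are small at the end of the window -/

/-- **The transiting modes of shell `k` relax behind a quiet feed.** Along a regular solution of the
`ν`-viscous `α_SB` lattice on `[0,s]` (`ν > 0`), fix a shell `k`, levels `r, σ > 0`, a pocket cap `Z > 0`,
a dip length `L > 0`, and put `Λ = Λ_k`, `Δ = 10Z/(Λσ²) + 1`, `r₁ = ΛZ/5 + ν_k`.  Suppose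
`[t₀, T] ⊆ [0,s]` with `t₀ + L + Δ ≤ T`, and on `[t₀,T]`: the feed is quiet, `Λ_{k-1}x_{k-1}² ≤ φ`;
`x_k, x_{k+1}, s_k ≥ 0`; `0 ≤ z_{k+1} ≤ Z`.  Parameter conditions: `φL ≤ r` (regrowth within a dip
window stays below `r`), `(4/5)Λr²Δ ≤ σ` (side regrowth within `Δ` stays below `σ`), `ν_{k+1}L ≤ 1`,
`ν_{k+1}Δ ≤ 1`, and the dip condition `2Z < (Λ/5)(Λr²/(5r₁))²(L − (1+log 2)/r₁)`.
Then **`x_k(T) < 2r` and `s_k(T) ≤ 2σ`**.  Proof: every `u ∈ [t₀+L, T]` has a dip of `x_k` below `r` in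
`[u−L,u]` (`sideBranch_chain_dip`) and regrows by `≤ φL ≤ r` (`sideBranch_chain_regrowth`); on
`[T−Δ, T]` the side mode dips to `≤ σ` (`sideBranch_side_dip`) and regrows by `≤ (4Λr²/5)Δ ≤ σ`
(`sideBranch_side_regrowth` with `Λx_k² ≤ 4Λr²`). [this file] -/
theorem sideBranch_shell_transit_relax (hε : 0 < ε₀) (hν : 0 < ν)
    (hder : ∀ (i : Fin 4) (k : ℤ), ∀ t ∈ Icc (0 : ℝ) s, HasDerivWithinAt (X i k)
      (quadTerm ε₀ sideBranchTable X i k t - ν * (1 + ε₀) ^ ((2 : ℝ) * k) * X i k t)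
      (Icc (0 : ℝ) s) t)
    (k : ℤ) {t₀ T φ r σ Z L : ℝ} (ht₀ : 0 ≤ t₀) (hTs : T ≤ s)
    (hr : 0 < r) (hσ : 0 < σ) (hZ : 0 < Z) (hL : 0 < L)
    (hwin : t₀ + L + (10 * Z / ((1 + ε₀) ^ ((5 : ℝ) * k / 2) * σ ^ 2) + 1) ≤ T)
    (hfeed : ∀ u ∈ Icc t₀ T, (1 + ε₀) ^ ((5 : ℝ) * ((k : ℝ) - 1) / 2) * X 0 (k - 1) u ^ 2 ≤ φ)
    (hxk : ∀ u ∈ Icc t₀ T, 0 ≤ X 0 k u)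
    (hx1 : ∀ u ∈ Icc t₀ T, 0 ≤ X 0 (k + 1) u)
    (hsk : ∀ u ∈ Icc t₀ T, 0 ≤ X 1 k u)
    (hz0 : ∀ u ∈ Icc t₀ T, 0 ≤ X 2 (k + 1) u)
    (hzZ : ∀ u ∈ Icc t₀ T, X 2 (k + 1) u ≤ Z)
    (hφL : φ * L ≤ r)
    (hrσ : (4 / 5 : ℝ) * (1 + ε₀) ^ ((5 : ℝ) * k / 2) * r ^ 2 *
      (10 * Z / ((1 + ε₀) ^ ((5 : ℝ) * k / 2) * σ ^ 2) + 1) ≤ σ)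
    (hνL : ν * (1 + ε₀) ^ ((2 : ℝ) * ((k + 1 : ℤ) : ℝ)) * L ≤ 1)
    (hνΔ : ν * (1 + ε₀) ^ ((2 : ℝ) * ((k + 1 : ℤ) : ℝ)) *
      (10 * Z / ((1 + ε₀) ^ ((5 : ℝ) * k / 2) * σ ^ 2) + 1) ≤ 1)
    (hdip : 2 * Z < (1 / 5 : ℝ) * (1 + ε₀) ^ ((5 : ℝ) * k / 2) *
        ((1 + ε₀) ^ ((5 : ℝ) * k / 2) * r ^ 2 /
          (5 * ((1 / 5 : ℝ) * (1 + ε₀) ^ ((5 : ℝ) * k / 2) * Z + ν * (1 + ε₀) ^ ((2 : ℝ) * k)))) ^ 2 *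
        (L - (1 + Real.log 2) /
          ((1 / 5 : ℝ) * (1 + ε₀) ^ ((5 : ℝ) * k / 2) * Z + ν * (1 + ε₀) ^ ((2 : ℝ) * k)))) :
    X 0 k T < 2 * r ∧ X 1 k T ≤ 2 * σ := by
  have hb : (0 : ℝ) < 1 + ε₀ := by linarith
  set Λ : ℝ := (1 + ε₀) ^ ((5 : ℝ) * k / 2) with hΛ
  set c₁ : ℝ := ν * (1 + ε₀) ^ ((2 : ℝ) * ((k + 1 : ℤ) : ℝ)) with hc₁
  have hΛ0 : 0 < Λ := Real.rpow_pos_of_pos hb _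
  have hc₁0 : 0 < c₁ := mul_pos hν (Real.rpow_pos_of_pos hb _)
  set Δ : ℝ := 10 * Z / (Λ * σ ^ 2) + 1 with hΔdef
  have hΔ0 : 0 < Δ := by
    have h1 : 0 ≤ 10 * Z / (Λ * σ ^ 2) := by positivity
    rw [hΔdef]; linarith
  have hφ0 : 0 ≤ φ := by
    have h1 := hfeed t₀ (left_mem_Icc.2 (by linarith))
    exact le_trans (mul_nonneg (Real.rpow_nonneg hb.le _) (sq_nonneg _)) h1
  -- Step 1: the chain mode is `< 2r` on `[t₀ + L, T]`
  have hchain : ∀ u ∈ Icc (t₀ + L) T, X 0 k u < 2 * r := by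
    intro u hu
    have huL0 : 0 ≤ u - L := by linarith [hu.1]
    have hut₀ : t₀ ≤ u - L := by linarith [hu.1]
    have hus : u ≤ s := hu.2.trans hTs
    have hsubw : Icc (u - L) u ⊆ Icc t₀ T := Icc_subset_Icc hut₀ hu.2
    -- dip in `[u − L, u]`
    have hlong : Z * (1 + c₁ * (u - (u - L))) <
        (1 / 5 : ℝ) * Λ * (Λ * r ^ 2 / (5 * ((1 / 5 : ℝ) * Λ * Z + ν * (1 + ε₀) ^ ((2 : ℝ) * k)))) ^ 2 *
          ((u - (u - L)) - (1 + Real.log 2) / ((1 / 5 : ℝ) * Λ * Z + ν * (1 + ε₀) ^ ((2 : ℝ) * k))) := by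
      have hw : u - (u - L) = L := by ring
      rw [hw]
      have h1 : Z * (1 + c₁ * L) ≤ 2 * Z := by nlinarith
      exact lt_of_le_of_lt h1 hdip
    obtain ⟨τ, hτmem, hτlt⟩ := sideBranch_chain_dip hε hν.le hder k huL0 (by linarith) hus
      (by positivity : (0 : ℝ) ≤ Λ * r ^ 2) hZ
      (fun w hw => hsk w (hsubw hw)) (fun w hw => hz0 w (hsubw hw)) (fun w hw => hzZ w (hsubw hw)) hlong
    -- `x_k(τ) < r`
    have hxτ : X 0 k τ < r := by
      by_contra hge
      rw [not_lt] at hge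
      have h1 : r ^ 2 ≤ X 0 k τ ^ 2 := pow_le_pow_left₀ hr.le hge 2
      have h2 : Λ * r ^ 2 ≤ Λ * X 0 k τ ^ 2 := mul_le_mul_of_nonneg_left h1 hΛ0.le
      linarith
    -- regrowth on `[τ, u]`
    have hτ0 : 0 ≤ τ := huL0.trans hτmem.1
    have hsubτ : Icc τ u ⊆ Icc t₀ T := Icc_subset_Icc (hut₀.trans hτmem.1) hu.2
    have hgrow := sideBranch_chain_regrowth hε hν.le hder k hτ0 hus
      (fun w hw => hfeed w (hsubτ hw)) (fun w hw => hxk w (hsubτ hw))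
      (fun w hw => hx1 w (hsubτ hw)) (fun w hw => hsk w (hsubτ hw)) (right_mem_Icc.2 hτmem.2)
    have h3 : φ * (u - τ) ≤ φ * L := mul_le_mul_of_nonneg_left (by linarith [hτmem.1]) hφ0
    linarith
  -- Step 2: the side mode dips to `≤ σ` in `[T − Δ, T]`
  have hT₂0 : 0 ≤ T - Δ := by rw [hΔdef, hΛ]; linarith
  have hT₂L : t₀ + L ≤ T - Δ := by rw [hΔdef, hΛ]; linarith
  have hsub2 : Icc (T - Δ) (T - Δ + Δ) ⊆ Icc t₀ T := by
    rw [sub_add_cancel]; exact Icc_subset_Icc (by linarith) le_rfl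
  have hΔs' : T - Δ + (10 * Z / ((1 + ε₀) ^ ((5 : ℝ) * k / 2) * σ ^ 2) + 1) ≤ s := by
    rw [← hΛ, ← hΔdef, sub_add_cancel]; exact hTs
  have hνΔ' : ν * (1 + ε₀) ^ ((2 : ℝ) * ((k + 1 : ℤ) : ℝ)) *
      (10 * Z / ((1 + ε₀) ^ ((5 : ℝ) * k / 2) * σ ^ 2) + 1) ≤ 1 := hνΔ
  obtain ⟨τ₁, hτ₁mem, hsτ₁⟩ := sideBranch_side_dip hε hν hder k hT₂0 hσ hZ hΔs'
    (fun w hw => hz0 w (hsub2 (by rwa [← hΛ, ← hΔdef] at hw)))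
    (fun w hw => hzZ w (hsub2 (by rwa [← hΛ, ← hΔdef] at hw))) hνΔ'
  rw [← hΛ, ← hΔdef] at hτ₁mem
  -- Step 3: side regrowth on `[τ₁, T]` with `Λx_k² ≤ 4Λr²`
  have hτ₁0 : 0 ≤ τ₁ := hT₂0.trans hτ₁mem.1
  have hτ₁T : τ₁ ≤ T := by have := hτ₁mem.2; rw [sub_add_cancel] at this; exact this
  have hsub3 : Icc τ₁ T ⊆ Icc (t₀ + L) T := Icc_subset_Icc (hT₂L.trans hτ₁mem.1) le_rfl
  have hsub3' : Icc τ₁ T ⊆ Icc t₀ T := Icc_subset_Icc (by linarith [hτ₁mem.1]) le_rfl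
  have hxa : ∀ w ∈ Icc τ₁ T, (1 + ε₀) ^ ((5 : ℝ) * k / 2) * X 0 k w ^ 2 ≤ 4 * Λ * r ^ 2 := by
    intro w hw
    rw [← hΛ]
    have h1 := hchain w (hsub3 hw)
    have h0 := hxk w (hsub3' hw)
    have h2 : X 0 k w ^ 2 ≤ (2 * r) ^ 2 := pow_le_pow_left₀ h0 h1.le 2
    nlinarith
  have hside := sideBranch_side_regrowth hε hν.le hder k hτ₁0 hTs hxa
    (fun w hw => hsk w (hsub3' hw)) (fun w hw => hz0 w (hsub3' hw)) (right_mem_Icc.2 hτ₁T)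
  have hgrowσ : 4 * Λ * r ^ 2 / 5 * (T - τ₁) ≤ σ := by
    have h1 : T - τ₁ ≤ Δ := by linarith [hτ₁mem.1]
    have h2 : 4 * Λ * r ^ 2 / 5 * (T - τ₁) ≤ 4 * Λ * r ^ 2 / 5 * Δ :=
      mul_le_mul_of_nonneg_left h1 (by positivity)
    have h3 : 4 * Λ * r ^ 2 / 5 * Δ = (4 / 5 : ℝ) * Λ * r ^ 2 * Δ := by ring
    rw [h3] at h2
    have h4 : (4 / 5 : ℝ) * Λ * r ^ 2 * Δ ≤ σ := by rw [hΔdef, hΛ]; exact hrσ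
    linarith
  refine ⟨hchain T (right_mem_Icc.2 (by linarith)), ?_⟩
  linarith

/-- **Energy form.** Under the hypotheses of `sideBranch_shell_transit_relax`:
`½x_k(T)² + ½s_k(T)² ≤ 2r² + 2σ²`. [this file] -/
theorem sideBranch_shell_transit_energy (hε : 0 < ε₀) (hν : 0 < ν)
    (hder : ∀ (i : Fin 4) (k : ℤ), ∀ t ∈ Icc (0 : ℝ) s, HasDerivWithinAt (X i k)
      (quadTerm ε₀ sideBranchTable X i k t - ν * (1 + ε₀) ^ ((2 : ℝ) * k) * X i k t)
      (Icc (0 : ℝ) s) t)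
    (k : ℤ) {t₀ T φ r σ Z L : ℝ} (ht₀ : 0 ≤ t₀) (hTs : T ≤ s)
    (hr : 0 < r) (hσ : 0 < σ) (hZ : 0 < Z) (hL : 0 < L)
    (hwin : t₀ + L + (10 * Z / ((1 + ε₀) ^ ((5 : ℝ) * k / 2) * σ ^ 2) + 1) ≤ T)
    (hfeed : ∀ u ∈ Icc t₀ T, (1 + ε₀) ^ ((5 : ℝ) * ((k : ℝ) - 1) / 2) * X 0 (k - 1) u ^ 2 ≤ φ)
    (hxk : ∀ u ∈ Icc t₀ T, 0 ≤ X 0 k u)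
    (hx1 : ∀ u ∈ Icc t₀ T, 0 ≤ X 0 (k + 1) u)
    (hsk : ∀ u ∈ Icc t₀ T, 0 ≤ X 1 k u)
    (hz0 : ∀ u ∈ Icc t₀ T, 0 ≤ X 2 (k + 1) u)
    (hzZ : ∀ u ∈ Icc t₀ T, X 2 (k + 1) u ≤ Z)
    (hφL : φ * L ≤ r)
    (hrσ : (4 / 5 : ℝ) * (1 + ε₀) ^ ((5 : ℝ) * k / 2) * r ^ 2 *
      (10 * Z / ((1 + ε₀) ^ ((5 : ℝ) * k / 2) * σ ^ 2) + 1) ≤ σ)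
    (hνL : ν * (1 + ε₀) ^ ((2 : ℝ) * ((k + 1 : ℤ) : ℝ)) * L ≤ 1)
    (hνΔ : ν * (1 + ε₀) ^ ((2 : ℝ) * ((k + 1 : ℤ) : ℝ)) *
      (10 * Z / ((1 + ε₀) ^ ((5 : ℝ) * k / 2) * σ ^ 2) + 1) ≤ 1)
    (hdip : 2 * Z < (1 / 5 : ℝ) * (1 + ε₀) ^ ((5 : ℝ) * k / 2) *
        ((1 + ε₀) ^ ((5 : ℝ) * k / 2) * r ^ 2 /
          (5 * ((1 / 5 : ℝ) * (1 + ε₀) ^ ((5 : ℝ) * k / 2) * Z + ν * (1 + ε₀) ^ ((2 : ℝ) * k)))) ^ 2 *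
        (L - (1 + Real.log 2) /
          ((1 / 5 : ℝ) * (1 + ε₀) ^ ((5 : ℝ) * k / 2) * Z + ν * (1 + ε₀) ^ ((2 : ℝ) * k)))) :
    (1 / 2 : ℝ) * X 0 k T ^ 2 + (1 / 2 : ℝ) * X 1 k T ^ 2 ≤ 2 * r ^ 2 + 2 * σ ^ 2 := by
  obtain ⟨hx, hs⟩ := sideBranch_shell_transit_relax hε hν hder k ht₀ hTs hr hσ hZ hL hwin hfeed hxk hx1
    hsk hz0 hzZ hφL hrσ hνL hνΔ hdip
  have hT : T ∈ Icc t₀ T := right_mem_Icc.2 (by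
    have : 0 < 10 * Z / ((1 + ε₀) ^ ((5 : ℝ) * k / 2) * σ ^ 2) + 1 := by
      have hb : (0 : ℝ) < 1 + ε₀ := by linarith
      have : 0 ≤ 10 * Z / ((1 + ε₀) ^ ((5 : ℝ) * k / 2) * σ ^ 2) := by positivity
      linarith
    linarith)
  have hx0 := hxk T hT
  have hs0 := hsk T hT
  have h1 : X 0 k T ^ 2 ≤ (2 * r) ^ 2 := pow_le_pow_left₀ hx0 hx.le 2
  have h2 : X 1 k T ^ 2 ≤ (2 * σ) ^ 2 := pow_le_pow_left₀ hs0 hs 2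
  nlinarith

end Solution

end Summit.NavierStokesRegularity.NavierStokesRegularity.Theorems.SubOnsagerCeiling

end
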